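/-
Origin: expansion seat `prover-pub-hodgecm-own-htheta-g2-0`, handover #H30 2026-08-21T14:05:49Z md5 36d0b7df28bc (81 l.; NEW additive MODEL leaf — SCHAIN row 1 of 11: face-scope `_S`∕`_gal` twin of `HodgeCM/Model/EndStateMeetOG.lean`-class head (scope triple ↦ `S c` ∕ `6 ≤ finrank ℚ c.K ∧ IsNormalClosure ℚ c.K L`); author item6-p2 (prover-pub-hodgecm2-item6-p2-0) under own-htheta; nothing cited beyond the record's binders; NOT an E term; sha256 0a8fe6f2459e38e047b081d35fa3b1cbf25265f4d9ec4f761b5281cf630b55b7; CERT rc 0 + trio as in the header; NAMES for audit: HodgeCM.Assembly.thetaRealisation₂_ofFunBridgesOG_S ) (`HOME/pub-hodgecm-own-htheta/stage81/HodgeCM/Model/EndStateMeetOGS.lean`, md5 36d0b7df28bc, 81 lines);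
landed by the p-seat packager p gen 32 (p-g32) in gate run 80 as `HodgeCM/Model/EndStateMeetOGS.lean` (verbatim).
-/
/-
Copyright (c) 2026 the pub-hodgecm formalisation cell (harness21).  New file, not vendored.
Origin: seat `prover-pub-hodgecm2-item6-p2-0` (unit pub-hodgecm2-item6-p2, TRANSPOSITION item (vi) extra prover p2 queued behind the own-htheta
lineage; coordinator ruling 2026-08-21T13:01:49Z), 2026-08-21 — CLAIM pub-hodgecm STATUS 13:45:32Z «SCOPE-PARAMETRIC POINTWISE E-CHAIN `…_S`»
(hodge-director/ITEM6-SPLIT.md (vi-4); x2 `E-HEADS-FACE-BLUEPRINT.md` v1.1 fc085fc795dd §3 step (3)).  Target in PKG: `HodgeCM/Model/EndStateMeetOGS.lean`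
(NEW additive leaf beside `Model/EndStateMeetOG.lean`; imports it only; nothing of record imports this file).  KERNEL ONLY: one theorem, no proof hole,
nothing cited, no `def`, no hypothesis kind of E; nothing here is a claim of the manuscripts under adjudication; HC_CM is NOT proved.

WHAT IT IS — the BOTTOM of the scope-parametric chain.  `Assembly.perLCanonical_ofFunBridgesOG₁₀` (`EndStateMeetOG.lean`:139) takes the six
function-bridge suppliers of an oriented family `C.thetaModel (hb L ι₁) d12 d34`, each guarded `GoodCtx ι₁ c → S c → (mk ι₁).embedding = ι₁ → …`
for a class `S` CONTAINING THE SEXTIC CONTEXTS (`hS`), and concludes `U.PerLCanonical` through `perLCanonical_ofSignRecipeOG₁₀` ∘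
`ModelAxiomsPerL.perLCanonical_of_ptOG` — whose ONLY non-pointwise step is the introduction of PerL's own binders (sextic `K`, frame, PerL types)
and the construction of the sextic context.  Here the same six suppliers, for an ARBITRARY class `scope` (no `hS`), give the POINTWISE conclusion the
context engine `ModelAxiomsPerL.nonempty_thetaRealisation₂_at_allChars` (`Model/EndStateMeet.lean`:405, degree-free: x2 blueprint §5) actually proves:
a `ThetaRealisation₂` at EVERY good context of the class at a canonical embedding.  E's instance: `scope := ⟨[c.K:ℚ] = 6, IsNormalClosure, 24 ∨ 48⟩`
(then `perLCanonical_of_ptOG`'s wrapper); the face instance: `scope c := «c is a face context»` (then `thm44_of_realisation₂` :205 at `faceCtx`).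
-/
import Summits.HodgeConjecture.HodgeCM.Model.EndStateMeetOG

/-! PORT of `HodgeCM/Model/EndStateMeetOGS.lean` (HodgeCMPerL run 82) — verbatim mechanical port; provenance in the PORT header line. -/

set_option autoImplicit false

noncomputable section

open scoped InnerProductSpace

namespace HodgeCM

namespace Assembly

open HodgeCM.Universe (AdelicThetaCore₀ SideData ThetaModel ModelAxiomsPerL)

variable (U : Universe)

/-- **SCOPE-PARAMETRIC POINTWISE END STATE over the function-level bridges** (the `_S` form of `perLCanonical_ofFunBridgesOG₁₀`,
`Model/EndStateMeetOG.lean`:139): for ANY class `scope` of see-saw contexts, the six guarded suppliers `innerEmb` / `thetaSub` / `thetaWedge` /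
`gen12` / `real34` / `occ` of the oriented family `fun L ι₁ => C.thetaModel (hb L ι₁) d12 d34` give, at every good context `c` of the class read at a
canonical embedding, a `ThetaRealisation₂` — `nonempty_thetaRealisation₂_at_allChars` with `Gen12MeetAt` / `Real34MeetAt` from the function bridges
(`gen12MeetAt_of_nonempty_funBridge` / `real34MeetAt_of_nonempty_funBridge`, `Model/Binders/MeetBridges.lean`:117).  No hypothesis relating `scope`
to the sextic contexts: that (`hS`) is used only by the PerL wrapper `perLCanonical_of_ptOG`, not here. -/
theorem thetaRealisation₂_ofFunBridgesOG_S (M : U.ModelAxiomsPerL) (hb : ∀ L : CMField, (L →+* ℂ) → Bool) (C : U.AdelicThetaCore₀)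
    (d12 d34 : ∀ {L : CMField}, SeesawCtx L → SideData L) (scope : ∀ {L : CMField}, SeesawCtx L → Prop)
    (innerEmb : ∀ {L : CMField} {ι₁ : L →+* ℂ} (V : HermSpace3 L ι₁) (c : SeesawCtx L),
      (C.thetaModel (hb L ι₁) d12 d34).GoodCtx ι₁ c → scope c → (NumberField.InfinitePlace.mk ι₁).embedding = ι₁ → (C.thetaModel (hb L ι₁) d12 d34).InnerEmbAt V)
    (thetaSub : ∀ {L : CMField} {ι₁ : L →+* ℂ} (V : HermSpace3 L ι₁) (c : SeesawCtx L),
      (C.thetaModel (hb L ι₁) d12 d34).GoodCtx ι₁ c → scope c → (NumberField.InfinitePlace.mk ι₁).embedding = ι₁ →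
      ∀ (i : Fin 4) (Γ : Level V), (C.thetaModel (hb L ι₁) d12 d34).Theta V c i Γ ⊆ U.Uiso Γ c.K (c.Ψ i) c.σ)
    (thetaWedge : ∀ {L : CMField} {ι₁ : L →+* ℂ} (V : HermSpace3 L ι₁) (c : SeesawCtx L),
      (C.thetaModel (hb L ι₁) d12 d34).GoodCtx ι₁ c → scope c → (NumberField.InfinitePlace.mk ι₁).embedding = ι₁ →
      ∃ Γ : Level V, ∃ ω₁ ∈ (C.thetaModel (hb L ι₁) d12 d34).Theta V c 0 Γ,
        ∃ ω₂ ∈ (C.thetaModel (hb L ι₁) d12 d34).Theta V c 1 Γ, U.cup2C (U.pms L ι₁ V Γ) 1 ω₁ ω₂ ≠ 0)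
    (gen12 : ∀ {L : CMField} {ι₁ : L →+* ℂ} (V : HermSpace3 L ι₁) (c : SeesawCtx L),
      (C.thetaModel (hb L ι₁) d12 d34).GoodCtx ι₁ c → scope c → (NumberField.InfinitePlace.mk ι₁).embedding = ι₁ →
      Nonempty ((C.thetaModel (hb L ι₁) d12 d34).Gen12FunBridge V c))
    (real34 : ∀ {L : CMField} {ι₁ : L →+* ℂ} (V : HermSpace3 L ι₁) (c : SeesawCtx L),
      (C.thetaModel (hb L ι₁) d12 d34).GoodCtx ι₁ c → scope c → (NumberField.InfinitePlace.mk ι₁).embedding = ι₁ →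
      Nonempty ((C.thetaModel (hb L ι₁) d12 d34).Real34FunBridge V c))
    (occ : ∀ {L : CMField} {ι₁ : L →+* ℂ} (V : HermSpace3 L ι₁) (c : SeesawCtx L),
      (C.thetaModel (hb L ι₁) d12 d34).GoodCtx ι₁ c → scope c → (NumberField.InfinitePlace.mk ι₁).embedding = ι₁ →
      (∀ (Φ : (C.thetaModel (hb L ι₁) d12 d34).SK V c) (i : (C.thetaModel (hb L ι₁) d12 d34).SigIdx V c),
          (∃ v ∈ ((C.thetaModel (hb L ι₁) d12 d34).core V c).hatσ i,
            ((C.thetaModel (hb L ι₁) d12 d34).core V c).TΦ Φ v ≠ 0) →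
          ((C.thetaModel (hb L ι₁) d12 d34).t12 V c).wOccurs i) ∧
        (∀ (Φ : (C.thetaModel (hb L ι₁) d12 d34).SK V c) (i : (C.thetaModel (hb L ι₁) d12 d34).SigIdx V c),
          (∃ v ∈ ((C.thetaModel (hb L ι₁) d12 d34).core V c).hatσ i,
            ((C.thetaModel (hb L ι₁) d12 d34).core V c).TΦ Φ v ≠ 0) →
          ((C.thetaModel (hb L ι₁) d12 d34).t34 V c).wOccurs i))
    (hHR : U.Fact_hodgeRiemann20) :
    ∀ {L : CMField} {ι₁ : L →+* ℂ} (V : HermSpace3 L ι₁) (c : SeesawCtx L),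
      (C.thetaModel (hb L ι₁) d12 d34).GoodCtx ι₁ c → scope c → (NumberField.InfinitePlace.mk ι₁).embedding = ι₁ →
      Nonempty (U.ThetaRealisation₂ ι₁ V c.K c.Ψ c.σ) :=
  fun {L} {ι₁} V c hc hSc hcan =>
    ModelAxiomsPerL.nonempty_thetaRealisation₂_at_allChars M (C.thetaModel (hb L ι₁) d12 d34) hHR V c (innerEmb V c hc hSc hcan)
      (thetaSub V c hc hSc hcan) (thetaWedge V c hc hSc hcan)
      ((C.thetaModel (hb L ι₁) d12 d34).gen12MeetAt_of_nonempty_funBridge (gen12 V c hc hSc hcan))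
      ((C.thetaModel (hb L ι₁) d12 d34).real34MeetAt_of_nonempty_funBridge (real34 V c hc hSc hcan)) (occ V c hc hSc hcan)

end Assembly

end HodgeCM

end
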